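import Summits.CriticalPhenomena.CardyFormulaZ2.Theses.CardyComplexCone
import Literature.Probability.RandomPlanarGeometry.ConformalTube
import Literature.Probability.Percolation.CardyFormula

/-!
# Skeleton line `conformal-collar-ss-bridge` for the crux `SLESixFamiliesGiveCardy`
(stmt-CriticalPhenomena-9654, route `CardyComplexCone`, rank 6)

Crux (fixed, by name): `SLESixFamiliesGiveCardy : SLE6Families → CardyFormulaZ2`, where
`SLE6Families` = "for every Dobrushin domain and every admissible discretisation family the
endpoint-oriented medial exploration curve of bond percolation on `δℤ²` at `p = 1/2` converges in
law to chordal SLE₆".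

Idea (card `Ideas/conformal-collar-ss-bridge.md`, triage r1-1/2/3 pass): spend the hypothesis
not on `(Ω; a, c)` but on an INNER CONFORMAL COLLAR RECTANGLE `R' ⊆ Ω` whose Dobrushin junctions
are analytic interior points of `Ω`; read only the OPEN proximity events
`mk '' hitsBeforeApprox` of the oriented interface (liminf half of portmanteau, honours the
refuted naive hitting transfer of `Disproof.lean`); convert proximity into lattice connections by
the escort chains of the exploration (`exists_left/right_chain_near`, proved); and cross the
conformally thin gap to the rough arcs of `Ω` with Schramm–Smirnov's side-perturbation lemma
(Ann. Probab. 39 (2011) Lemma 6.1, RSW + lowest crossing), proved NATIVELY for G02's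
`discreteCrossing` — once for the crossed sides `(ab),(cd)` (`stub_collarBridge`) and once, dually,
for the uncrossed sides `(bc),(da)` (`stub_dualCollarBridge`, the upper bound).

COLLARS. All collars are disc-chart collars: for a Carathéodory chart `C` of `Ω`
(`JordanDomain.DiscChart`, a tree theorem: `exists_discChart_apply_eq`) and `i : Fin 4`,

  `coll i s := C.Φ '' {u | ‖u‖ < 1 ∧ infDist u (C.β '' Icc (R.mark i) (R.nextMark i)) < s}`,

the image of the `s`-neighbourhood in `𝔻` of the preimage arc of `R.arc i`.  `Φ` is uniformly
continuous on the CLOSED disc, so every point of `coll i s` is joined to `R.arc i` inside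
`closure Ω` by a path of diameter `≤ ω_Φ(s) → 0` (the "Carathéodory-short joins" of the card); no
point at infinity occurs (the `ℍ`-datum `(φ, x)` of the summit statement enters only through
`cardyFunction (crossRatio x)`).

Composition: `hasCrossingLimit_of_stubs : stub₁-stmt → … → stub₅-stmt → SLE6Families → ∀ R,
R.HasCrossingLimit (bondDomainCrossingProb R) cardyFunction` is pure `ε/8`-bookkeeping in the shape
of `Disproof.limit_of_liminf_of_compl` (two one-sided bounds for complementary proximity events of
ONE interface; `p + q ≤ 1` is replaced by the dual bridge's conclusion `≤ 1 - p + ε`), sorry-free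
with axioms `propext / Classical.choice / Quot.sound`; `SLESixFamiliesGiveCardy_of : <crux decl>`
applies it to the five registered `stub_*` theorems and is the unique theorem of the file
concluding the crux by name (skeleton audit: sorries only inside the stubs).  No named fact is
used by the composition.
-/

namespace Summit.CriticalPhenomena.CardyFormulaZ2.Cruxes.SLESixFamiliesGiveCardy.ConformalCollarSsBridge

open scoped Topology
open Filter Set MeasureTheory
open UpperHalfPlane (upperHalfPlaneSet)
open Literature.Probability.Percolation Literature.Probability.LatticeModels
open Literature.Probability.RandomPlanarGeometry

/-- **stub_proximityLiminf (SLE side; M/L).** For ANY family of curve-class valued interfaces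
`X δ` on bond configurations converging in law to chordal SLE₆ in `(Ω'; a', c') = R'.chord 0 2`,
and any uniformizing datum `(φ', x')` of `R'`, the OPEN proximity events
`U₂(a,b) = mk '' hitsBeforeApprox (R'.arc 2) (R'.arc 1) a b` ("comes `a`-close to `(c'd')` before
`b`-close to `(b'c')`") and `U₁(a,b) = mk '' hitsBeforeApprox (R'.arc 1) (R'.arc 2) a b` satisfy the
one-sided bounds `P[X δ ∈ U₂(a,b)] ≥ F(η') - θ` and `P[X δ ∈ U₁(a,b)] ≥ 1 - F(η') - θ` eventually,
for some `b = b(θ) > 0` and every `a > 0`.  Proof sketch: `mk` is an open quotient map and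
`isOpen_hitsBeforeApprox`, so portmanteau (liminf over open sets,
`convergesInLawToSLE_iff_tendstoInDistribution`) applies; `hitsBefore_eq_iUnion_iInter` (the
`G_δσ` exhaustion, monotone in `a` and `b`) and the discharged hitting law
`sle_six_measureReal_hitsBefore_holds` give `μ_SLE(U₂(a, 1/(n+1))) ≥ F(η') - θ` for `n ≥ n(θ)` and
all `a`; the second bound is the first for the MIRROR rectangle (same carrier, boundary
orientation reversed, marks `a', d', c', b'`; its `(0,2)`-chord has the same carrier and
endpoints hence the same SLE₆ laws), whose cross-ratio is `1 - η'` (Möbius invariance,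
`crossRatio` swap of marks 1 and 3), together with `cardyFunction_one_sub_holds`.  Honours
`Disproof.not_naiveHittingTransfer`: no hitting probability of a lattice curve is ever
transferred. [size M/L] -/
theorem stub_proximityLiminf :
    ∀ (R' : ConformalRectangle) (X : ℝ → BondConfig (Site 2) → CurveClass ℂ),
      ConvergesInLawToSLE 6 (R'.chord 0 2 (by decide)) (Ωδ := fun _ => BondConfig (Site 2)) X
          (fun _ => bondPercolation (zdGraph 2) half) →
      ∀ (φ' : ConformalEquiv upperHalfPlaneSet R'.carrier) (x' : Fin 4 → ℝ),
        R'.IsUniformizing φ' x' →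
        ∀ θ > (0:ℝ), ∃ b > (0:ℝ), ∀ a > (0:ℝ), ∀ᶠ δ in 𝓝[>] (0:ℝ),
          cardyFunction (crossRatio x') - θ ≤
              (bondPercolation (zdGraph 2) half).real
                ((X δ) ⁻¹' (CurveClass.mk '' CurveClass.hitsBeforeApprox (R'.arc 2) (R'.arc 1) a b)) ∧
          1 - cardyFunction (crossRatio x') - θ ≤
              (bondPercolation (zdGraph 2) half).real
                ((X δ) ⁻¹' (CurveClass.mk '' CurveClass.hitsBeforeApprox (R'.arc 1) (R'.arc 2) a b)) := by
  sorry

/-- **stub_collarRectangle (conformal geometry + the auxiliary Dobrushin problem; L).** Given a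
conformal rectangle `R = (Ω; a, b, c, d)`, a disc chart `C`, a uniformizing datum `(φ, x)`, a
collar width `s > 0` and `θ > 0`, there is an INNER COLLAR RECTANGLE `R' = (Ω'; a', p₂, c', p₄)`
with `Ω' ⊆ Ω`, a uniformizing datum `(φ', x')` with `|F(crossRatio x') - F(crossRatio x)| ≤ θ`, a
margin `lam > 0` such that the `lam`-neighbourhood (inside `Ω`) of `R'.arc i` lies in the collar
`coll i s` of `R.arc i` for each `i`, and of `Ω ∖ Ω'` lies in `coll 1 s ∪ coll 3 s`, AND an
admissible discretisation family `Λ` of the Dobrushin domain `R'.chord 0 2 = (Ω'; a', c')` (the six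
`ZdDiscretisationFamily` fields, unbundled verbatim as in the crux antecedent).  Intended
construction: `Ω' = C.Φ (G)` with `G = {u ∈ 𝔻 | infDist u A₁ > s', infDist u A₃ > s'}`
(`Aᵢ = C.β '' Icc (mark i) (nextMark i)`, `s' ≪ s`), a Jordan domain bounded by sub-arcs of
`(ab), (cd)` and two ANALYTIC crosscuts; junctions `a', c'` on the crosscuts at conformal height
`s₀ ≪ s` above `(ab)` resp. below `(cd)` (so rough marks never carry a junction); `p₂, p₄` the
crosscut feet; inclusions by uniform continuity of `C.Φ⁻¹` on `closure Ω` (compact-to-Hausdorff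
continuous bijection); modulus closeness by Radó (`rado_tendstoUniformlyOn_holds`) or Carathéodory
kernel convergence as `s', s₀ → 0` plus `continuousOn_cardyFunction_Ioo` and
`crossRatio_eq_of_isUniformizing_holds`; the family by a local thick-staircase / generic split
point at the two analytic junctions (template `UnitDiscDiscretisation.discData`,
`familyHyps_discData`; one-face-wide necks with differently labelled walls occur only at the
junctions — Disproof note for item 9644 — and are excluded there for small `δ`).  The lead may
carve the family clause out as a `--supports` lemma (card: NiceJunctionFamily). [size L] -/
theorem stub_collarRectangle :
    ∀ (R : ConformalRectangle) (C : R.toJordanDomain.DiscChart)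
      (φ : ConformalEquiv upperHalfPlaneSet R.carrier) (x : Fin 4 → ℝ), R.IsUniformizing φ x →
      ∀ s > (0:ℝ), ∀ θ > (0:ℝ),
        ∃ (R' : ConformalRectangle) (φ' : ConformalEquiv upperHalfPlaneSet R'.carrier)
          (x' : Fin 4 → ℝ) (lam : ℝ) (Λ : ℝ → DiscreteDobrushin),
          R'.IsUniformizing φ' x' ∧ 0 < lam ∧ R'.carrier ⊆ R.carrier ∧
          |cardyFunction (crossRatio x') - cardyFunction (crossRatio x)| ≤ θ ∧
          (∀ i : Fin 4, {z : ℂ | z ∈ R.carrier ∧ Metric.infDist z (R'.arc i) < lam} ⊆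
              C.Φ '' {u : ℂ | ‖u‖ < 1 ∧
                Metric.infDist u (C.β '' Set.Icc (R.mark i) (R.nextMark i)) < s}) ∧
          {z : ℂ | z ∈ R.carrier ∧ Metric.infDist z (R.carrier \ R'.carrier) < lam} ⊆
              C.Φ '' {u : ℂ | ‖u‖ < 1 ∧
                Metric.infDist u (C.β '' Set.Icc (R.mark 1) (R.nextMark 1)) < s} ∪
              C.Φ '' {u : ℂ | ‖u‖ < 1 ∧
                Metric.infDist u (C.β '' Set.Icc (R.mark 3) (R.nextMark 3)) < s} ∧
          (∀ δ, (Λ δ).Ω = (R'.chord 0 2 (by decide)).carrier) ∧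
          (∀ δ, (Λ δ).δ = δ) ∧
          Tendsto (fun δ : ℝ => Metric.hausdorffEDist (Λ δ).arcA ((R'.chord 0 2 (by decide)).arc 0))
            (𝓝[>] (0:ℝ)) (𝓝 0) ∧
          Tendsto (fun δ : ℝ => Metric.hausdorffEDist (Λ δ).arcB ((R'.chord 0 2 (by decide)).arc 1))
            (𝓝[>] (0:ℝ)) (𝓝 0) ∧
          Tendsto (fun δ : ℝ => Metric.hausdorffEDist (medialPoint δ '' (Λ δ).zdABEdges)
              {(R'.chord 0 2 (by decide)).pt 0, (R'.chord 0 2 (by decide)).pt 1})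
            (𝓝[>] (0:ℝ)) (𝓝 0) ∧
          (∀ᶠ δ in 𝓝[>] (0:ℝ), (Λ δ).IsZdAdmissible) := by
  sorry

/-- **stub_collarBridge (percolation only, RSW; L) — Schramm–Smirnov's side perturbation for the
CROSSED sides, G02-native.** For every `ε > 0` there is a collar width `s > 0` such that,
eventually as `δ → 0⁺`, an `ω`-open path of the discrete domain `Ω_δ = discreteDomainGraph Ω δ`
from (a site whose mesh point lies in) the conformal collar `coll 0 s` of `(ab)` to the collar
`coll 2 s` of `(cd)` is, up to probability `ε`, a genuine free crossing
`discreteCrossing Ω δ (ab) (cd)` (largest component, `meshBoundary` sites, distance-rule arcs):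
`P[collar-to-collar] ≤ P[C_δ] + ε`.  Proof template: SS11 (arXiv:1101.5820) Lemma 6.1 case (2)
applied twice (move `∂₂`, then, after the relabelling `i ↦ i + 2`, move `∂₀`) to `Q =` the
`R`-quad and the sub-quads cut off by the level curves `{infDist u Aᵢ = s}`; the `δ₁`-short joins
are the `C.Φ`-images of straight segments in the closed disc (`δ₁ = ω_Φ(s)`, uniform continuity
of `C.Φ` on `closedBall 0 1`); the RSW circuits live in plane annuli around the landing point of
the LOWEST crossing (an interior point of `Ω`), their exit arcs leave `Ω` through `meshBoundary`
sites of the giant component lying in `discreteArc (cd)` by the distance rule — the tree fact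
`SchrammSmirnov2011_lemma_6_1` (SS quads, `crossedEvent`) is a TEMPLATE ONLY (triage r1-1/r1-3:
the deterministic bridge `crossedEvent → discreteCrossing` is false).  Degenerate instance
`u = v` is excluded by choosing `s` below half the distance of the two preimage arcs (triage
r1-2). Tree RSW inputs: `annulusOpenCrossing_half_le_holds`, `annulusDualCrossing_half_le_holds`,
`JordanDomain.exists_forall_mem_meshDomain_and_reachable`, `MeshStrayExtent`. [size L] -/
theorem stub_collarBridge :
    ∀ (R : ConformalRectangle) (C : R.toJordanDomain.DiscChart), ∀ ε > (0:ℝ), ∃ s > (0:ℝ),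
      ∀ᶠ δ in 𝓝[>] (0:ℝ),
        (bondPercolation (zdGraph 2) half).real
            {ω | ∃ u v : Site 2,
              meshPoint δ u ∈ C.Φ '' {w : ℂ | ‖w‖ < 1 ∧
                Metric.infDist w (C.β '' Set.Icc (R.mark 0) (R.nextMark 0)) < s} ∧
              meshPoint δ v ∈ C.Φ '' {w : ℂ | ‖w‖ < 1 ∧
                Metric.infDist w (C.β '' Set.Icc (R.mark 2) (R.nextMark 2)) < s} ∧
              (openGraph ω ⊓ discreteDomainGraph R.carrier δ).Reachable u v}
          ≤ bondDomainCrossingProb R δ + ε := by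
  sorry

/-- **stub_dualCollarBridge (percolation only, RSW + planar duality; L) — the side perturbation
for the UNCROSSED sides, read dually; this is the upper bound (triage r1-3 sharpening (2)).**
For every `ε > 0` there is `s > 0` such that, eventually in `δ`, a CERTIFIED CLOSED DUAL CHAIN
from the collar `coll 1 s` of `(bc)` to the collar `coll 3 s` of `(da)` — a chain of faces
`g 0, …, g N` (indexed by lower-left corners, consecutive faces equal or `ℤ²`-adjacent) such that
every primal edge of `Ω_δ` crossed by a step of the chain and having BOTH endpoints outside
`coll 1 s ∪ coll 3 s` is `ω`-closed — excludes the free crossing `C_δ(Ω; ab, cd)` up to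
probability `ε`: `P[certified chain] ≤ 1 - P[C_δ] + ε`.  Proof template: (i) deterministic planar
exclusion — a certified chain forbids every open `(ab) ↔ (cd)` crossing of `Ω_δ` whose vertices
avoid (a `δ`-neighbourhood of) the two collars (a primal path and a dual chain cross only at a
primal edge `e` with `dualEdge e` a step); (ii) `P[C_δ(Q) ∖ C_δ(Q_{2s})] ≤ Δ_c(ω_Φ(2s), d) → 0`,
`Q_{2s}` the quad with sides 1, 3 pushed in along the level curves — SS11 Lemma 6.1 case (2) for
the DUAL model (sides 1, 3 are the landing sides of the dual crossing; cf. the duality remark in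
SS11's proof of case (1)), again with `C.Φ`-short joins and lowest-crossing RSW in unexplored
territory.  The lead may split (i)/(ii) as `--supports` lemmas. [size L] -/
theorem stub_dualCollarBridge :
    ∀ (R : ConformalRectangle) (C : R.toJordanDomain.DiscChart), ∀ ε > (0:ℝ), ∃ s > (0:ℝ),
      ∀ᶠ δ in 𝓝[>] (0:ℝ),
        (bondPercolation (zdGraph 2) half).real
            {ω | ∃ (g : ℕ → Site 2) (N : ℕ),
              meshPoint δ (g 0) ∈ C.Φ '' {w : ℂ | ‖w‖ < 1 ∧
                Metric.infDist w (C.β '' Set.Icc (R.mark 1) (R.nextMark 1)) < s} ∧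
              meshPoint δ (g N) ∈ C.Φ '' {w : ℂ | ‖w‖ < 1 ∧
                Metric.infDist w (C.β '' Set.Icc (R.mark 3) (R.nextMark 3)) < s} ∧
              ∀ j < N, (g j = g (j + 1) ∨ (zdGraph 2).Adj (g j) (g (j + 1))) ∧
                ∀ e ∈ (discreteDomainGraph R.carrier δ).edgeSet, dualEdge e = s(g j, g (j + 1)) →
                  (∀ w ∈ e, meshPoint δ w ∉
                    C.Φ '' {w : ℂ | ‖w‖ < 1 ∧
                      Metric.infDist w (C.β '' Set.Icc (R.mark 1) (R.nextMark 1)) < s} ∪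
                    C.Φ '' {w : ℂ | ‖w‖ < 1 ∧
                      Metric.infDist w (C.β '' Set.Icc (R.mark 3) (R.nextMark 3)) < s}) →
                  e ∉ ω}
          ≤ 1 - bondDomainCrossingProb R δ + ε := by
  sorry

/-- **stub_escortChains (deterministic lattice geometry; L) — the escort chains of the oriented
exploration of the collar Dobrushin problem, read in `Ω_δ`.**  Let `R' ⊆ R` be a collar rectangle
with margin `lam` as in `stub_collarRectangle` (arc `i` of `R'` has its `lam`-neighbourhood in
`coll i s`, the removed region `Ω ∖ Ω'` has its `lam`-neighbourhood in `coll 1 s ∪ coll 3 s`) and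
`Λ` a discretisation family of `R'.chord 0 2`.  Then for `0 < a < lam` and `b > 0`, eventually in
`δ`, for EVERY configuration `ω`: (1) if the endpoint-oriented exploration curve class (verbatim
the crux's interface map) lies in `mk '' hitsBeforeApprox (R'.arc 2) (R'.arc 1) a b`, then some site
with mesh point in `coll 0 s` is joined to some site with mesh point in `coll 2 s` by an `ω`-open
path of `Ω_δ = discreteDomainGraph R.carrier δ`; (2) if it lies in
`mk '' hitsBeforeApprox (R'.arc 1) (R'.arc 2) a b`, there is a certified closed dual chain from
`coll 1 s` to `coll 3 s` (verbatim the event of `stub_dualCollarBridge`).  Proof sketch: the list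
`medialExploration (Λ δ) ω` is a genuine exploration (`existsUnique_medialExploration_holds` +
eventual admissibility); ORIENTATION CASE SPLIT by the endpoint rule (Disproof §2b
`orientation_loadBearing`; both A–B edges are `o(1)`-close to `{a', c'}`, so the oriented start is
the edge at `a' = R'.pt 0`); on the event, `exists_left_chain_near` (resp. `exists_right_chain_near`,
both proved, `ExplorationCrossings.lean`) on the time window up to (forward) / from (reversed) the
proximity time gives a `bcBondConfig`-open chain of left vertices (resp. a
`dualConfig ∘ bcBondConfig`-open chain of right INNER faces) within `δ` (`3δ`) of the curve, hence
`> b - 3δ` from `R'.arc 1` (resp. `R'.arc 2`); cut the vertex chain at its last (forward) / first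
(reversed) `zdArcA` site — that site is within `2δ + o(1)` of `arcA ⊆ (R'.arc 0 ∪ R'.arc 1)_{o(1)}`,
hence near `R'.arc 0` — the rest is `ω`-open in `Ω'_δ` (`mem_bcBondConfig_iff`; cf.
`Disproof.exactDictionary_holds`, `left_reachable`); `Ω'_δ`-edges far from `Ω ∖ Ω'` are
`Ω_δ`-edges and conversely (segments of length `δ < lam`, giant components by
`JordanDomain.mul_sub_lt_of_stray` / `exists_forall_mem_meshDomain_and_reachable`); certification:
a crossed primal edge of `Ω_δ` with endpoints outside the collars is an `Ω'_δ`-edge not touching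
`zdArcB` (which is `2δ + o(1)`-close to `R'.arc 2 ∪ R'.arc 3`, the chain being `b - 3δ` away from
`R'.arc 2` and `R'.arc 3`'s neighbourhood lying inside `coll 3 s`), hence `ω`-closed. [size L] -/
theorem stub_escortChains :
    ∀ (R : ConformalRectangle) (C : R.toJordanDomain.DiscChart) (s lam : ℝ) (R' : ConformalRectangle)
      (Λ : ℝ → DiscreteDobrushin),
      0 < lam → R'.carrier ⊆ R.carrier →
      (∀ i : Fin 4, {z : ℂ | z ∈ R.carrier ∧ Metric.infDist z (R'.arc i) < lam} ⊆
          C.Φ '' {u : ℂ | ‖u‖ < 1 ∧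
            Metric.infDist u (C.β '' Set.Icc (R.mark i) (R.nextMark i)) < s}) →
      {z : ℂ | z ∈ R.carrier ∧ Metric.infDist z (R.carrier \ R'.carrier) < lam} ⊆
          C.Φ '' {u : ℂ | ‖u‖ < 1 ∧
            Metric.infDist u (C.β '' Set.Icc (R.mark 1) (R.nextMark 1)) < s} ∪
          C.Φ '' {u : ℂ | ‖u‖ < 1 ∧
            Metric.infDist u (C.β '' Set.Icc (R.mark 3) (R.nextMark 3)) < s} →
      (∀ δ, (Λ δ).Ω = (R'.chord 0 2 (by decide)).carrier) →
      (∀ δ, (Λ δ).δ = δ) →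
      Tendsto (fun δ : ℝ => Metric.hausdorffEDist (Λ δ).arcA ((R'.chord 0 2 (by decide)).arc 0))
        (𝓝[>] (0:ℝ)) (𝓝 0) →
      Tendsto (fun δ : ℝ => Metric.hausdorffEDist (Λ δ).arcB ((R'.chord 0 2 (by decide)).arc 1))
        (𝓝[>] (0:ℝ)) (𝓝 0) →
      Tendsto (fun δ : ℝ => Metric.hausdorffEDist (medialPoint δ '' (Λ δ).zdABEdges)
          {(R'.chord 0 2 (by decide)).pt 0, (R'.chord 0 2 (by decide)).pt 1})
        (𝓝[>] (0:ℝ)) (𝓝 0) →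
      (∀ᶠ δ in 𝓝[>] (0:ℝ), (Λ δ).IsZdAdmissible) →
      ∀ a b : ℝ, 0 < a → a < lam → 0 < b →
        ∀ᶠ δ in 𝓝[>] (0:ℝ), ∀ ω : BondConfig (Site 2),
          (CurveClass.mk (if dist (medialExplorationCurve (Λ δ) ω 0) ((R'.chord 0 2 (by decide)).pt 0) ≤
                dist (medialExplorationCurve (Λ δ) ω 0) ((R'.chord 0 2 (by decide)).pt 1)
              then (⟨medialExplorationCurve (Λ δ) ω⟩ : Curve ℂ)
              else ⟨(medialExplorationCurve (Λ δ) ω).comp ⟨unitInterval.symm, unitInterval.continuous_symm⟩⟩)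
              ∈ CurveClass.mk '' CurveClass.hitsBeforeApprox (R'.arc 2) (R'.arc 1) a b →
            ∃ u v : Site 2,
              meshPoint δ u ∈ C.Φ '' {w : ℂ | ‖w‖ < 1 ∧
                Metric.infDist w (C.β '' Set.Icc (R.mark 0) (R.nextMark 0)) < s} ∧
              meshPoint δ v ∈ C.Φ '' {w : ℂ | ‖w‖ < 1 ∧
                Metric.infDist w (C.β '' Set.Icc (R.mark 2) (R.nextMark 2)) < s} ∧
              (openGraph ω ⊓ discreteDomainGraph R.carrier δ).Reachable u v) ∧
          (CurveClass.mk (if dist (medialExplorationCurve (Λ δ) ω 0) ((R'.chord 0 2 (by decide)).pt 0) ≤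
                dist (medialExplorationCurve (Λ δ) ω 0) ((R'.chord 0 2 (by decide)).pt 1)
              then (⟨medialExplorationCurve (Λ δ) ω⟩ : Curve ℂ)
              else ⟨(medialExplorationCurve (Λ δ) ω).comp ⟨unitInterval.symm, unitInterval.continuous_symm⟩⟩)
              ∈ CurveClass.mk '' CurveClass.hitsBeforeApprox (R'.arc 1) (R'.arc 2) a b →
            ∃ (g : ℕ → Site 2) (N : ℕ),
              meshPoint δ (g 0) ∈ C.Φ '' {w : ℂ | ‖w‖ < 1 ∧
                Metric.infDist w (C.β '' Set.Icc (R.mark 1) (R.nextMark 1)) < s} ∧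
              meshPoint δ (g N) ∈ C.Φ '' {w : ℂ | ‖w‖ < 1 ∧
                Metric.infDist w (C.β '' Set.Icc (R.mark 3) (R.nextMark 3)) < s} ∧
              ∀ j < N, (g j = g (j + 1) ∨ (zdGraph 2).Adj (g j) (g (j + 1))) ∧
                ∀ e ∈ (discreteDomainGraph R.carrier δ).edgeSet, dualEdge e = s(g j, g (j + 1)) →
                  (∀ w ∈ e, meshPoint δ w ∉
                    C.Φ '' {w : ℂ | ‖w‖ < 1 ∧
                      Metric.infDist w (C.β '' Set.Icc (R.mark 1) (R.nextMark 1)) < s} ∪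
                    C.Φ '' {w : ℂ | ‖w‖ < 1 ∧
                      Metric.infDist w (C.β '' Set.Icc (R.mark 3) (R.nextMark 3)) < s}) →
                  e ∉ ω) := by
  sorry

/-! ### Composition -/

/-- Collars are monotone in their width. -/
theorem collar_mono {Φ : ℂ → ℂ} {A : Set ℂ} {s t : ℝ} (hst : s ≤ t) :
    Φ '' {u : ℂ | ‖u‖ < 1 ∧ Metric.infDist u A < s} ⊆ Φ '' {u : ℂ | ‖u‖ < 1 ∧ Metric.infDist u A < t} :=
  Set.image_mono fun _ hu => ⟨hu.1, hu.2.trans_le hst⟩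

/-- **The five stub STATEMENTS, as explicit hypotheses, plus the crux's antecedent (SLE₆ for every
Dobrushin domain and family, verbatim) give the crux's consequent in its unfolded form
`∀ R, R.HasCrossingLimit (bondDomainCrossingProb R) cardyFunction` (= `CardyFormulaZ2`).**
Order of hypotheses: `stub_proximityLiminf → stub_collarRectangle → stub_collarBridge →
stub_dualCollarBridge → stub_escortChains → SLE6Families → …`.  Given a conformal rectangle `R`
and a datum `(φ, x)`, fix a disc chart `C`; for `ε > 0` take the collar widths `s₁, s₂` of the
two bridges at `ε/8`, the collar rectangle `R'` at width `min s₁ s₂` and modulus error `ε/8` with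
its family `Λ`, apply the SLE₆ hypothesis to `(R'.chord 0 2, Λ)`, take `b = b(ε/8)` from the
proximity bounds and `a = lam/2`; eventually in `δ`: `F - 3ε/8 ≤ P[C_δ] ≤ F + 3ε/8`.
Sorry-free, axioms `propext / Classical.choice / Quot.sound`; no named fact.  (This is the
arrow-shaped composition; `SLESixFamiliesGiveCardy_of` below applies it to the registered stubs
and is the unique theorem of this file concluding the crux by name.) -/
theorem hasCrossingLimit_of_stubs :
    (∀ (R' : ConformalRectangle) (X : ℝ → BondConfig (Site 2) → CurveClass ℂ),
      ConvergesInLawToSLE 6 (R'.chord 0 2 (by decide)) (Ωδ := fun _ => BondConfig (Site 2)) X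
          (fun _ => bondPercolation (zdGraph 2) half) →
      ∀ (φ' : ConformalEquiv upperHalfPlaneSet R'.carrier) (x' : Fin 4 → ℝ),
        R'.IsUniformizing φ' x' →
        ∀ θ > (0:ℝ), ∃ b > (0:ℝ), ∀ a > (0:ℝ), ∀ᶠ δ in 𝓝[>] (0:ℝ),
          cardyFunction (crossRatio x') - θ ≤
              (bondPercolation (zdGraph 2) half).real
                ((X δ) ⁻¹' (CurveClass.mk '' CurveClass.hitsBeforeApprox (R'.arc 2) (R'.arc 1) a b)) ∧
          1 - cardyFunction (crossRatio x') - θ ≤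
              (bondPercolation (zdGraph 2) half).real
                ((X δ) ⁻¹' (CurveClass.mk '' CurveClass.hitsBeforeApprox (R'.arc 1) (R'.arc 2) a b))) →
    (∀ (R : ConformalRectangle) (C : R.toJordanDomain.DiscChart)
      (φ : ConformalEquiv upperHalfPlaneSet R.carrier) (x : Fin 4 → ℝ), R.IsUniformizing φ x →
      ∀ s > (0:ℝ), ∀ θ > (0:ℝ),
        ∃ (R' : ConformalRectangle) (φ' : ConformalEquiv upperHalfPlaneSet R'.carrier)
          (x' : Fin 4 → ℝ) (lam : ℝ) (Λ : ℝ → DiscreteDobrushin),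
          R'.IsUniformizing φ' x' ∧ 0 < lam ∧ R'.carrier ⊆ R.carrier ∧
          |cardyFunction (crossRatio x') - cardyFunction (crossRatio x)| ≤ θ ∧
          (∀ i : Fin 4, {z : ℂ | z ∈ R.carrier ∧ Metric.infDist z (R'.arc i) < lam} ⊆
              C.Φ '' {u : ℂ | ‖u‖ < 1 ∧
                Metric.infDist u (C.β '' Set.Icc (R.mark i) (R.nextMark i)) < s}) ∧
          {z : ℂ | z ∈ R.carrier ∧ Metric.infDist z (R.carrier \ R'.carrier) < lam} ⊆
              C.Φ '' {u : ℂ | ‖u‖ < 1 ∧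
                Metric.infDist u (C.β '' Set.Icc (R.mark 1) (R.nextMark 1)) < s} ∪
              C.Φ '' {u : ℂ | ‖u‖ < 1 ∧
                Metric.infDist u (C.β '' Set.Icc (R.mark 3) (R.nextMark 3)) < s} ∧
          (∀ δ, (Λ δ).Ω = (R'.chord 0 2 (by decide)).carrier) ∧
          (∀ δ, (Λ δ).δ = δ) ∧
          Tendsto (fun δ : ℝ => Metric.hausdorffEDist (Λ δ).arcA ((R'.chord 0 2 (by decide)).arc 0))
            (𝓝[>] (0:ℝ)) (𝓝 0) ∧
          Tendsto (fun δ : ℝ => Metric.hausdorffEDist (Λ δ).arcB ((R'.chord 0 2 (by decide)).arc 1))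
            (𝓝[>] (0:ℝ)) (𝓝 0) ∧
          Tendsto (fun δ : ℝ => Metric.hausdorffEDist (medialPoint δ '' (Λ δ).zdABEdges)
              {(R'.chord 0 2 (by decide)).pt 0, (R'.chord 0 2 (by decide)).pt 1})
            (𝓝[>] (0:ℝ)) (𝓝 0) ∧
          (∀ᶠ δ in 𝓝[>] (0:ℝ), (Λ δ).IsZdAdmissible)) →
    (∀ (R : ConformalRectangle) (C : R.toJordanDomain.DiscChart), ∀ ε > (0:ℝ), ∃ s > (0:ℝ),
      ∀ᶠ δ in 𝓝[>] (0:ℝ),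
        (bondPercolation (zdGraph 2) half).real
            {ω | ∃ u v : Site 2,
              meshPoint δ u ∈ C.Φ '' {w : ℂ | ‖w‖ < 1 ∧
                Metric.infDist w (C.β '' Set.Icc (R.mark 0) (R.nextMark 0)) < s} ∧
              meshPoint δ v ∈ C.Φ '' {w : ℂ | ‖w‖ < 1 ∧
                Metric.infDist w (C.β '' Set.Icc (R.mark 2) (R.nextMark 2)) < s} ∧
              (openGraph ω ⊓ discreteDomainGraph R.carrier δ).Reachable u v}
          ≤ bondDomainCrossingProb R δ + ε) →
    (∀ (R : ConformalRectangle) (C : R.toJordanDomain.DiscChart), ∀ ε > (0:ℝ), ∃ s > (0:ℝ),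
      ∀ᶠ δ in 𝓝[>] (0:ℝ),
        (bondPercolation (zdGraph 2) half).real
            {ω | ∃ (g : ℕ → Site 2) (N : ℕ),
              meshPoint δ (g 0) ∈ C.Φ '' {w : ℂ | ‖w‖ < 1 ∧
                Metric.infDist w (C.β '' Set.Icc (R.mark 1) (R.nextMark 1)) < s} ∧
              meshPoint δ (g N) ∈ C.Φ '' {w : ℂ | ‖w‖ < 1 ∧
                Metric.infDist w (C.β '' Set.Icc (R.mark 3) (R.nextMark 3)) < s} ∧
              ∀ j < N, (g j = g (j + 1) ∨ (zdGraph 2).Adj (g j) (g (j + 1))) ∧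
                ∀ e ∈ (discreteDomainGraph R.carrier δ).edgeSet, dualEdge e = s(g j, g (j + 1)) →
                  (∀ w ∈ e, meshPoint δ w ∉
                    C.Φ '' {w : ℂ | ‖w‖ < 1 ∧
                      Metric.infDist w (C.β '' Set.Icc (R.mark 1) (R.nextMark 1)) < s} ∪
                    C.Φ '' {w : ℂ | ‖w‖ < 1 ∧
                      Metric.infDist w (C.β '' Set.Icc (R.mark 3) (R.nextMark 3)) < s}) →
                  e ∉ ω}
          ≤ 1 - bondDomainCrossingProb R δ + ε) →
    (∀ (R : ConformalRectangle) (C : R.toJordanDomain.DiscChart) (s lam : ℝ) (R' : ConformalRectangle)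
      (Λ : ℝ → DiscreteDobrushin),
      0 < lam → R'.carrier ⊆ R.carrier →
      (∀ i : Fin 4, {z : ℂ | z ∈ R.carrier ∧ Metric.infDist z (R'.arc i) < lam} ⊆
          C.Φ '' {u : ℂ | ‖u‖ < 1 ∧
            Metric.infDist u (C.β '' Set.Icc (R.mark i) (R.nextMark i)) < s}) →
      {z : ℂ | z ∈ R.carrier ∧ Metric.infDist z (R.carrier \ R'.carrier) < lam} ⊆
          C.Φ '' {u : ℂ | ‖u‖ < 1 ∧
            Metric.infDist u (C.β '' Set.Icc (R.mark 1) (R.nextMark 1)) < s} ∪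
          C.Φ '' {u : ℂ | ‖u‖ < 1 ∧
            Metric.infDist u (C.β '' Set.Icc (R.mark 3) (R.nextMark 3)) < s} →
      (∀ δ, (Λ δ).Ω = (R'.chord 0 2 (by decide)).carrier) →
      (∀ δ, (Λ δ).δ = δ) →
      Tendsto (fun δ : ℝ => Metric.hausdorffEDist (Λ δ).arcA ((R'.chord 0 2 (by decide)).arc 0))
        (𝓝[>] (0:ℝ)) (𝓝 0) →
      Tendsto (fun δ : ℝ => Metric.hausdorffEDist (Λ δ).arcB ((R'.chord 0 2 (by decide)).arc 1))
        (𝓝[>] (0:ℝ)) (𝓝 0) →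
      Tendsto (fun δ : ℝ => Metric.hausdorffEDist (medialPoint δ '' (Λ δ).zdABEdges)
          {(R'.chord 0 2 (by decide)).pt 0, (R'.chord 0 2 (by decide)).pt 1})
        (𝓝[>] (0:ℝ)) (𝓝 0) →
      (∀ᶠ δ in 𝓝[>] (0:ℝ), (Λ δ).IsZdAdmissible) →
      ∀ a b : ℝ, 0 < a → a < lam → 0 < b →
        ∀ᶠ δ in 𝓝[>] (0:ℝ), ∀ ω : BondConfig (Site 2),
          (CurveClass.mk (if dist (medialExplorationCurve (Λ δ) ω 0) ((R'.chord 0 2 (by decide)).pt 0) ≤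
                dist (medialExplorationCurve (Λ δ) ω 0) ((R'.chord 0 2 (by decide)).pt 1)
              then (⟨medialExplorationCurve (Λ δ) ω⟩ : Curve ℂ)
              else ⟨(medialExplorationCurve (Λ δ) ω).comp ⟨unitInterval.symm, unitInterval.continuous_symm⟩⟩)
              ∈ CurveClass.mk '' CurveClass.hitsBeforeApprox (R'.arc 2) (R'.arc 1) a b →
            ∃ u v : Site 2,
              meshPoint δ u ∈ C.Φ '' {w : ℂ | ‖w‖ < 1 ∧
                Metric.infDist w (C.β '' Set.Icc (R.mark 0) (R.nextMark 0)) < s} ∧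
              meshPoint δ v ∈ C.Φ '' {w : ℂ | ‖w‖ < 1 ∧
                Metric.infDist w (C.β '' Set.Icc (R.mark 2) (R.nextMark 2)) < s} ∧
              (openGraph ω ⊓ discreteDomainGraph R.carrier δ).Reachable u v) ∧
          (CurveClass.mk (if dist (medialExplorationCurve (Λ δ) ω 0) ((R'.chord 0 2 (by decide)).pt 0) ≤
                dist (medialExplorationCurve (Λ δ) ω 0) ((R'.chord 0 2 (by decide)).pt 1)
              then (⟨medialExplorationCurve (Λ δ) ω⟩ : Curve ℂ)
              else ⟨(medialExplorationCurve (Λ δ) ω).comp ⟨unitInterval.symm, unitInterval.continuous_symm⟩⟩)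
              ∈ CurveClass.mk '' CurveClass.hitsBeforeApprox (R'.arc 1) (R'.arc 2) a b →
            ∃ (g : ℕ → Site 2) (N : ℕ),
              meshPoint δ (g 0) ∈ C.Φ '' {w : ℂ | ‖w‖ < 1 ∧
                Metric.infDist w (C.β '' Set.Icc (R.mark 1) (R.nextMark 1)) < s} ∧
              meshPoint δ (g N) ∈ C.Φ '' {w : ℂ | ‖w‖ < 1 ∧
                Metric.infDist w (C.β '' Set.Icc (R.mark 3) (R.nextMark 3)) < s} ∧
              ∀ j < N, (g j = g (j + 1) ∨ (zdGraph 2).Adj (g j) (g (j + 1))) ∧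
                ∀ e ∈ (discreteDomainGraph R.carrier δ).edgeSet, dualEdge e = s(g j, g (j + 1)) →
                  (∀ w ∈ e, meshPoint δ w ∉
                    C.Φ '' {w : ℂ | ‖w‖ < 1 ∧
                      Metric.infDist w (C.β '' Set.Icc (R.mark 1) (R.nextMark 1)) < s} ∪
                    C.Φ '' {w : ℂ | ‖w‖ < 1 ∧
                      Metric.infDist w (C.β '' Set.Icc (R.mark 3) (R.nextMark 3)) < s}) →
                  e ∉ ω)) →
    -- the crux's antecedent `SLE6Families`, verbatim
    (∀ (D : DobrushinDomain) (Λ : ℝ → DiscreteDobrushin), (∀ δ, (Λ δ).Ω = D.carrier) →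
      (∀ δ, (Λ δ).δ = δ) →
      Filter.Tendsto (fun δ : ℝ => Metric.hausdorffEDist (Λ δ).arcA (D.arc 0))
        (nhdsWithin (0:ℝ) (Set.Ioi 0)) (nhds 0) →
      Filter.Tendsto (fun δ : ℝ => Metric.hausdorffEDist (Λ δ).arcB (D.arc 1))
        (nhdsWithin (0:ℝ) (Set.Ioi 0)) (nhds 0) →
      Filter.Tendsto (fun δ : ℝ => Metric.hausdorffEDist (medialPoint δ '' (Λ δ).zdABEdges) {D.pt 0, D.pt 1})
        (nhdsWithin (0:ℝ) (Set.Ioi 0)) (nhds 0) →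
      (∀ᶠ δ in nhdsWithin (0:ℝ) (Set.Ioi 0), (Λ δ).IsZdAdmissible) →
      ConvergesInLawToSLE 6 D (Ωδ := fun _ => BondConfig (Site 2))
        (fun δ ω => CurveClass.mk (if dist (medialExplorationCurve (Λ δ) ω 0) (D.pt 0) ≤
            dist (medialExplorationCurve (Λ δ) ω 0) (D.pt 1) then
          (⟨medialExplorationCurve (Λ δ) ω⟩ : Curve ℂ)
          else ⟨(medialExplorationCurve (Λ δ) ω).comp ⟨unitInterval.symm, unitInterval.continuous_symm⟩⟩))
        (fun _ => bondPercolation (zdGraph 2) half)) →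
    ∀ R : ConformalRectangle, R.HasCrossingLimit (bondDomainCrossingProb R) cardyFunction := by
  intro hprox hrect hbridge hdual hesc hSLE R φ x hφx
  rw [Metric.tendsto_nhds]
  intro ε hε
  -- a disc chart of `Ω`
  obtain ⟨z₀, hz₀⟩ := R.toJordanDomain.nonempty
  obtain ⟨C, -⟩ := R.toJordanDomain.exists_discChart_apply_eq hz₀
  have hθ : (0:ℝ) < ε / 8 := by positivity
  -- collar widths of the two bridges
  obtain ⟨s₁, hs₁, hbr⟩ := hbridge R C (ε / 8) hθ
  obtain ⟨s₂, hs₂, hdu⟩ := hdual R C (ε / 8) hθ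
  have hs : (0:ℝ) < min s₁ s₂ := lt_min hs₁ hs₂
  -- the inner collar rectangle, its datum, margin and discretisation family
  obtain ⟨R', φ', x', lam, Λ, hφ', hlam, hsub, hF, harcs, hthin, hΩ, hδ, hA, hB, hAB, hadm⟩ :=
    hrect R C φ x hφx (min s₁ s₂) hs (ε / 8) hθ
  -- the crux hypothesis: SLE₆ for the collar Dobrushin problem
  have hconv := hSLE (R'.chord 0 2 (by decide)) Λ hΩ hδ hA hB hAB hadm
  -- proximity bounds
  obtain ⟨b, hb, hab⟩ := hprox R' _ hconv φ' x' hφ' (ε / 8) hθ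
  have ha : (0:ℝ) < lam / 2 := by positivity
  have halam : lam / 2 < lam := by linarith
  have h1 := hab (lam / 2) ha
  have h2 := hesc R C (min s₁ s₂) lam R' Λ hlam hsub harcs hthin hΩ hδ hA hB hAB hadm
    (lam / 2) b ha halam hb
  filter_upwards [h1, h2, hbr, hdu] with δ h1 h2 h3 h4
  have hm₁ : min s₁ s₂ ≤ s₁ := min_le_left _ _
  have hm₂ : min s₁ s₂ ≤ s₂ := min_le_right _ _
  -- lower bound: proximity ⊆ collar-to-collar open path ⊆ crossing up to ε/8
  have hlow : cardyFunction (crossRatio x') - ε / 8 ≤ bondDomainCrossingProb R δ + ε / 8 := by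
    refine h1.1.trans (le_trans (measureReal_mono ?_) h3)
    intro ω hω
    obtain ⟨u, v, hu, hv, huv⟩ := (h2 ω).1 hω
    exact ⟨u, v, collar_mono hm₁ hu, collar_mono hm₁ hv, huv⟩
  -- upper bound: complementary proximity ⊆ certified dual chain ⊆ no crossing up to ε/8
  have hup : 1 - cardyFunction (crossRatio x') - ε / 8 ≤ 1 - bondDomainCrossingProb R δ + ε / 8 := by
    refine h1.2.trans (le_trans (measureReal_mono ?_) h4)
    intro ω hω
    obtain ⟨g, N, hg0, hgN, hstep⟩ := (h2 ω).2 hω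
    refine ⟨g, N, collar_mono hm₂ hg0, collar_mono hm₂ hgN, fun j hj => ⟨(hstep j hj).1, ?_⟩⟩
    intro e he hde hout
    refine (hstep j hj).2 e he hde fun w hw hmem => hout w hw ?_
    rcases hmem with hmem | hmem
    · exact Or.inl (collar_mono hm₂ hmem)
    · exact Or.inr (collar_mono hm₂ hmem)
  rw [Real.dist_eq, abs_lt]
  have hF' := abs_le.1 hF
  constructor <;> linarith [hF'.1, hF'.2]

/-- **The line concludes the crux BY NAME.**  The registered stubs (the only `sorry`s of this
file) fed into the sorry-free composition `hasCrossingLimit_of_stubs`; as the stubs are proved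
this theorem becomes the crux proof.  (`#print axioms` shows `sorryAx` exactly through the five
`stub_*` declarations.) -/
theorem SLESixFamiliesGiveCardy_of :
    Summit.CriticalPhenomena.CardyFormulaZ2.Theses.CardyComplexCone.SLESixFamiliesGiveCardy :=
  fun hSLE => hasCrossingLimit_of_stubs stub_proximityLiminf stub_collarRectangle stub_collarBridge
    stub_dualCollarBridge stub_escortChains hSLE

end Summit.CriticalPhenomena.CardyFormulaZ2.Cruxes.SLESixFamiliesGiveCardy.ConformalCollarSsBridge
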